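import Literature.AlgebraicGeometry.Resolution.TaylorOrderBound
import Mathlib.RingTheory.Smooth.AdicCompletion
import Mathlib.RingTheory.AdicCompletion.Completeness
import Mathlib.RingTheory.MvPowerSeries.Inverse
import Mathlib.RingTheory.Localization.Basic
import HarnessLib

/-!
# Hasse–Schmidt homomorphisms on algebras formally smooth over affine space, and on their localisations

Topic: `Literature/AlgebraicGeometry/Resolution`. Let `K` be a commutative ring, `R = K[X_σ]` (`σ` finite) and `A`
a commutative `K`-algebra with a compatible `R`-algebra structure which is FORMALLY SMOOTH over `R` (e.g. an
étale, or standard smooth, extension of a polynomial ring: Mathlib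
`Algebra.IsStandardSmoothOfRelativeDimension.exists_etale_mvPolynomial`). Write `x_i ∈ A` for the image of `X_i`.

* `exists_hasseSchmidt_of_formallySmooth` — there is a ring homomorphism `T : A → A⟦t_σ⟧` with
  `constantCoeff ∘ T = id` («Hasse–Schmidt homomorphism») extending the TAYLOR SHIFT `X_i ↦ x_i + t_i` of `R`
  (so `T` sends `K` to constants and `T(x_i) = x_i + t_i`). Proof: `A⟦t⟧` is `(t)`-adically complete (Mathlib's
  instance for `MvPowerSeries`), `a ↦ a mod (t)` is an `R`-algebra map `A → A⟦t⟧/(t)` for the shifted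
  `R`-structure, and formal smoothness lifts it (Mathlib `Algebra.FormallySmooth.exists_mkₐ_comp_eq_of_isAdicComplete`;
  this is the infinitesimal lifting property iterated, EGA IV₄ 17.1.1 / 0_IV 19.3.10).
* `exists_hasseSchmidt_localization` — a Hasse–Schmidt homomorphism `T` of `A` fixing `K` induces one on every
  localisation `O = M⁻¹A` compatible with `A → O` (`T(s)` is a unit of `O⟦t⟧` for `s ∈ M`: its constant term is).
* `hsComponent_single_isDerivation` — the degree-one components `D^{[e_j]}` of a Hasse–Schmidt homomorphism are
  derivations (Leibniz with two terms), hence `D^{[e_j]}(π(a)) = π′(a) · D^{[e_j]}(a)` for polynomials `π ∈ K[X]`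
  (`hsComponent_single_aeval`).

These are the inputs of the order criterion at closed points of smooth schemes (`HasseSchmidtLocalCriterion.lean`,
`SmoothPointOrderCriterion.lean`). Sources: [EGAIV4] §16.11, 17.1; [Matsumura1987] §25–§27 (higher derivations
and their extension along 0-smooth / étale maps, Thm. 27.2).
-/

noncomputable section

namespace Literature.AlgebraicGeometry.Resolution

open MvPowerSeries

universe u v w

section Lift

variable (K : Type u) [CommRing K] {σ : Type v} [Fintype σ]
  (A : Type w) [CommRing A] [Algebra K A] [Algebra (MvPolynomial σ K) A]
  [IsScalarTower K (MvPolynomial σ K) A]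

/-- **Existence of a Hasse–Schmidt homomorphism extending the Taylor shift** on a formally smooth algebra over
the polynomial ring `K[X_σ]`: a ring map `T : A → A⟦t_σ⟧` with `constantCoeff ∘ T = id` and
`T(r(x)) = r(x + t)` for `r ∈ K[X_σ]` (in particular `T` fixes `K` and `T(x_i) = x_i + t_i`).
[cite: EGAIV4, Prop. 17.1.1 and §16.11] [cite: Matsumura1987, Thm. 27.2 (§27)] -/
theorem exists_hasseSchmidt_of_formallySmooth [Algebra.FormallySmooth (MvPolynomial σ K) A] :
    ∃ T : A →+* MvPowerSeries σ A,
      (∀ a : A, constantCoeff (T a) = a) ∧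
      ∀ r : MvPolynomial σ K, T (algebraMap (MvPolynomial σ K) A r) =
        MvPolynomial.eval₂ (MvPowerSeries.C.comp (algebraMap K A))
          (fun i => MvPowerSeries.C (algebraMap (MvPolynomial σ K) A (MvPolynomial.X i)) + MvPowerSeries.X i) r := by
  classical
  -- the shifted `K[X]`-algebra structure on `B = A⟦t⟧`: `X_i ↦ x_i + t_i`
  let φ : MvPolynomial σ K →+* MvPowerSeries σ A := MvPolynomial.eval₂Hom (MvPowerSeries.C.comp (algebraMap K A))
    (fun i => MvPowerSeries.C (algebraMap (MvPolynomial σ K) A (MvPolynomial.X i)) + MvPowerSeries.X i)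
  letI : Algebra (MvPolynomial σ K) (MvPowerSeries σ A) := φ.toAlgebra
  let I : Ideal (MvPowerSeries σ A) := Ideal.span (Set.range MvPowerSeries.X)
  -- the two ring maps `K[X] → B ⧸ I`, `r ↦ r(x + t)` and `r ↦ r(x)`, agree
  have hagree : (Ideal.Quotient.mk I).comp φ =
      (Ideal.Quotient.mk I).comp (MvPowerSeries.C.comp (algebraMap (MvPolynomial σ K) A)) := by
    refine MvPolynomial.ringHom_ext (fun c => ?_) (fun i => ?_)
    · simp only [RingHom.comp_apply, φ, MvPolynomial.coe_eval₂Hom, MvPolynomial.eval₂_C]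
      congr 2
      rw [IsScalarTower.algebraMap_apply K (MvPolynomial σ K) A c]
      rfl
    · simp only [RingHom.comp_apply, φ, MvPolynomial.coe_eval₂Hom, MvPolynomial.eval₂_X]
      rw [Ideal.Quotient.eq, add_sub_cancel_left]
      exact Ideal.subset_span ⟨i, rfl⟩
  -- `a ↦ a mod (t)` as a `K[X]`-algebra map `A → B ⧸ I`
  let f : A →ₐ[MvPolynomial σ K] MvPowerSeries σ A ⧸ I :=
    { (Ideal.Quotient.mk I).comp (MvPowerSeries.C (σ := σ) (R := A)) with
      commutes' := fun r => by
        have h := congrArg (fun g : MvPolynomial σ K →+* MvPowerSeries σ A ⧸ I => g r) hagree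
        simp only [RingHom.comp_apply] at h
        simp only [RingHom.toMonoidHom_eq_coe, OneHom.toFun_eq_coe, MonoidHom.toOneHom_coe, MonoidHom.coe_coe,
          RingHom.coe_comp, Function.comp_apply]
        rw [← h]
        rfl }
  obtain ⟨T, hT⟩ := Algebra.FormallySmooth.exists_mkₐ_comp_eq_of_isAdicComplete (I := I) f
  refine ⟨T.toRingHom, fun a => ?_, fun r => ?_⟩
  · -- `T a ≡ C a (mod I)` and `I ≤ ker constantCoeff`
    have h1 : Ideal.Quotient.mk I (T a) = Ideal.Quotient.mk I (MvPowerSeries.C a) := by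
      have h := congrArg (fun g : A →ₐ[MvPolynomial σ K] MvPowerSeries σ A ⧸ I => g a) hT
      simp only [AlgHom.comp_apply, Ideal.Quotient.mkₐ_eq_mk] at h
      exact h
    rw [Ideal.Quotient.eq] at h1
    have hker : I ≤ RingHom.ker (MvPowerSeries.constantCoeff (σ := σ) (R := A)) := by
      rw [Ideal.span_le]
      rintro _ ⟨i, rfl⟩
      simp
    have h2 := hker h1
    rw [RingHom.mem_ker, map_sub, MvPowerSeries.constantCoeff_C, sub_eq_zero] at h2
    exact h2
  · -- `T` is a `K[X]`-algebra map for the shifted structure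
    have h := T.commutes r
    rw [RingHom.algebraMap_toAlgebra] at h
    exact h

end Lift

section Localization

variable {K : Type u} [CommRing K] {σ : Type v}
  {A : Type w} [CommRing A] [Algebra K A] (T : A →+* MvPowerSeries σ A)
  (O : Type*) [CommRing O] [Algebra A O] [Algebra K O] [IsScalarTower K A O]

/-- **A Hasse–Schmidt homomorphism passes to localisations**: if `T : A → A⟦t⟧` has `constantCoeff ∘ T = id` and
fixes `K`, then on `O = M⁻¹A` there is `T_O : O → O⟦t⟧` with the same two properties and
`T_O ∘ (A → O) = (A⟦t⟧ → O⟦t⟧) ∘ T` (universal property: `T(s)`, `s ∈ M`, is a unit of `O⟦t⟧` because its constant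
term is). [cite: Matsumura1987, §27 (higher derivations extend to localisations)] -/
theorem exists_hasseSchmidt_localization (M : Submonoid A) [IsLocalization M O]
    (hT0 : ∀ a : A, constantCoeff (T a) = a)
    (hTK : ∀ c : K, T (algebraMap K A c) = MvPowerSeries.C (algebraMap K A c)) :
    ∃ TO : O →+* MvPowerSeries σ O,
      (∀ b : O, constantCoeff (TO b) = b) ∧
      (∀ c : K, TO (algebraMap K O c) = MvPowerSeries.C (algebraMap K O c)) ∧
      ∀ a : A, TO (algebraMap A O a) = MvPowerSeries.map (algebraMap A O) (T a) := by
  set g : A →+* MvPowerSeries σ O := (MvPowerSeries.map (algebraMap A O)).comp T with hg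
  have hunit : ∀ y : M, IsUnit (g y) := by
    intro y
    rw [MvPowerSeries.isUnit_iff_constantCoeff, hg, RingHom.comp_apply, MvPowerSeries.constantCoeff_map, hT0]
    exact IsLocalization.map_units O y
  refine ⟨IsLocalization.lift hunit, ?_, ?_, fun a => IsLocalization.lift_eq hunit a⟩
  · -- `constantCoeff ∘ T_O` and `id` agree on the image of `A`
    have : (MvPowerSeries.constantCoeff (σ := σ) (R := O)).comp (IsLocalization.lift hunit) = RingHom.id O := by
      refine IsLocalization.ringHom_ext M ?_
      ext a
      simp [hg, hT0]
    exact fun b => congrArg (fun h : O →+* O => h b) this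
  · intro c
    rw [IsScalarTower.algebraMap_apply K A O c, IsLocalization.lift_eq hunit, hg, RingHom.comp_apply, hTK,
      MvPowerSeries.map_C]

end Localization

section Derivation

variable {K : Type u} [CommRing K] {σ : Type v} [DecidableEq σ]
  {B : Type w} [CommRing B] [Algebra K B] (T : B →+* MvPowerSeries σ B)

/-- **Degree-one components are derivations**: for a Hasse–Schmidt homomorphism (`constantCoeff ∘ T = id`),
`D^{[e_j]}(ab) = D^{[e_j]}(a) b + a D^{[e_j]}(b)`. [cite: Matsumura1987, §27 (higher derivations)] -/
theorem hsComponent_single_mul (hT0 : ∀ b : B, constantCoeff (T b) = b) (j : σ) (a b : B) :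
    hsComponent T (Finsupp.single j 1) (a * b) =
      hsComponent T (Finsupp.single j 1) a * b + a * hsComponent T (Finsupp.single j 1) b := by
  rw [hsComponent_mul, Finsupp.antidiagonal_single, Finset.sum_map, Finset.Nat.sum_antidiagonal_succ,
    Finset.Nat.antidiagonal_zero, Finset.sum_singleton]
  simp only [Function.Embedding.coe_prodMap, Function.Embedding.coeFn_mk, Prod.map_apply, zero_add,
    Finsupp.single_zero, hsComponent_zero T hT0]
  ring

/-- **Chain rule for the degree-one components**: `D^{[e_j]}(π(a)) = π′(a) · D^{[e_j]}(a)` for `π ∈ K[X]`, for a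
Hasse–Schmidt homomorphism fixing `K` (its degree-one components are `K`-derivations).
[cite: Matsumura1987, §27 (higher derivations)] -/
theorem hsComponent_single_aeval (hT0 : ∀ b : B, constantCoeff (T b) = b)
    (hTK : ∀ c : K, T (algebraMap K B c) = MvPowerSeries.C (algebraMap K B c)) (j : σ) (π : Polynomial K)
    (a : B) :
    hsComponent T (Finsupp.single j 1) (Polynomial.aeval a π) =
      Polynomial.aeval a (Polynomial.derivative π) * hsComponent T (Finsupp.single j 1) a := by
  let D : Derivation K B B := Derivation.mk'
    { toFun := hsComponent T (Finsupp.single j 1)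
      map_add' := hsComponent_add T _
      map_smul' := fun c b => by
        simp only [hsComponent, Algebra.smul_def, map_mul, hTK, RingHom.id_apply]
        rw [MvPowerSeries.coeff_C_mul] }
    (fun a b => by
      simp only [LinearMap.coe_mk, AddHom.coe_mk, smul_eq_mul, hsComponent_single_mul T hT0]
      ring)
  have key : ∀ b, D b = hsComponent T (Finsupp.single j 1) b := fun b => rfl
  have h := D.map_aeval π a
  rw [key, key, smul_eq_mul] at h
  exact h

end Derivation

end Literature.AlgebraicGeometry.Resolution

end
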